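import Literature.AlgebraicGeometry.ShimuraVarieties.UnitaryShimuraCurveHeckePoints
import Literature.AlgebraicGeometry.ShimuraVarieties.UnitaryConeHeckeTranslation
import Literature.AlgebraicGeometry.HodgeTheory.ComplexConjugationHolds
import Literature.NumberTheory.Transcendental.AnalytificationMorphismsProofs
import HarnessLib

/-!
# The Hecke translate `[v, aK] ↦ [v, agK']` of the canonical model of the unitary Shimura CURVE is a morphism of
# the complex fibres ([Milne 2005] §13 p. 118 L25–26 «The map `T(g)` is a morphism of algebraic varieties over `ℂ`»,
# for the compact Shimura curve `Sh(U(J⋆), 𝔻)`, from the record's `pieces`) — the complex half of conjunct u1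

Topic `AlgebraicGeometry/ShimuraVarieties`, namespace `…ShimuraVarieties.UnitaryCanonicalModel` (the object of ★
`UnitaryShimuraCurveRecord`). THEOREMS ONLY (no definition, no named fact, no `sorry`).

For the record system `S : RecordSystemGS L J⋆ τ K₀` of Deligne's canonical model of the Shimura CURVE `Sh(U(J⋆), 𝔻)`
(★ GS-2), two small levels `K, K' ≤ K₀` and `g ∈ U(J⋆)(𝔸_{L⁺,f})` with `g⁻¹Kg ≤ K'`, **there is a morphism
`T_ℂ : (M_K)_τ → (M_{K'})_τ` of the complex fibres over `ℂ` acting on complex points as `[v, aK] ↦ [v, agK']`**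
(`RecordSystemGS.exists_heckeComplex`) — the rank-2, cone-coordinate twin of ★ `RecordSystem.exists_heckeComplex`
(`UnitaryShimuraHeckeComplex.lean`), by the same printed argument: on the piece `X_q = Γ_{J⋆}(g_qKg_q⁻¹) \ 𝔻` of the
record's clause (F2c) `pieces` choose `γ ∈ U(J⋆)(L⁺)` and `q'` with `g_q g ∈ φ(γ)⁻¹ g'_{q'} K'`
(`exists_rational_inv_mul_rep_mem`); then `[v, g_q g K'] = [γ^τ v, g'_{q'} K']`, and `v ↦ γ^τ v` descends to the disc
quotients because `γ Γ(g_qKg_q⁻¹) γ⁻¹ ≤ Γ(g'_{q'}K'g'_{q'}⁻¹)` (`map_conj_arithmeticLevel_le`, from `g⁻¹Kg ≤ K'`); it is a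
`ℂ`-MORPHISM `X_q → X'_{q'}` by ★ `UnitaryConeHeckeTranslation.exists_hom_map_unif_mulVec_eq_of_nonempty` — for CURVES
the holomorphy of the translation descends along the open holomorphic uniformisation of the one-dimensional
`X_q^an` (★ `HolomorphyDescent`, Riemann's removable singularities theorem; Hodge models by ★
`exists_isReal_hodgeModel_holds 1`; algebraicity by Arapura Cor. 15.4.6 = ★ `arapura2012_cor_15_4_6_holds`) — and the
pieces glue by the universal property of the coproduct (`Cofan.IsColimit.desc`).  §1 is rank-GENERIC bookkeeping
(`n`, any Gram matrix): representatives of `U(J)(L⁺) \ U(J)(𝔸_f) / K` and conjugation of natural levels.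

With the descent half ([Milne2005ShimuraVarieties] Thm. 13.6 by its printed proof, for the curve:
`RecordSystemGS.heckeTranslateDefinedOver_of_complex`, cell `hodgecm-mathlib` A-p08 (F2)) this yields conjunct u1
`S.HeckeTranslateDefinedOver` of the cited existence fact ★ `exists_recordSystemGS` as a THEOREM for every record `S`.

## References
* [Milne2005ShimuraVarieties] J. S. Milne, *Introduction to Shimura varieties* (2005; held rev. 2017
  `paper:url-b0e8e4ca1c12`), §13 p. 118 L21–28 (Thm. 13.6), Lemma 5.13 p. 57.
* [Deligne1979ShimuraVarieties] P. Deligne, *Variétés de Shimura* (1979), 2.1.2–2.1.4 (the pieces `Γ_g \ X⁺`).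
* [Arapura2012] D. Arapura, *Algebraic Geometry over the Complex Numbers* (2012), Cor. 15.4.6.
* [Forster1981] O. Forster, *Lectures on Riemann Surfaces* (1981), §1 Thm. 1.8.
-/

set_option autoImplicit false

noncomputable section

open Function MulAction Topology NumberField IsDedekindDomain CategoryTheory CategoryTheory.Limits Matrix
  AlgebraicGeometry
open scoped Matrix ComplexOrder
open Literature.AlgebraicGeometry.Motives
open Literature.NumberTheory.Automorphic Literature.NumberTheory.Automorphic.UnitaryGroup
open Literature.NumberTheory.Automorphic.Liu2021.AppendixC (C5.OpenCompactSubgroup C5.SmallLevel)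
open Literature.NumberTheory.Automorphic.ShimuraDissection
open Literature.AlgebraicGeometry.HodgeTheory (HodgeModel)
open Literature.NumberTheory.Transcendental (arapura2012_cor_15_4_6_holds)

namespace Literature.AlgebraicGeometry.ShimuraVarieties.UnitaryCanonicalModel

variable {L : Type} [Field L] [NumberField L] [IsCMField L]

/-! ### §1. Group-theoretic bookkeeping at any rank: representatives, conjugate levels -/

omit [IsCMField L] in
/-- Every double class has the chosen representative up to a rational element: for representatives `g_q` of
`Ξ_K = U(J)(L⁺) \ U(J)(𝔸_f) / K` and any `a`, there is `γ ∈ U(J)(L⁺)` with `(φ(γ) a)⁻¹ g_{[a]} ∈ K`, i.e.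
`a K = φ(γ)⁻¹ g_{[a]} K` («`[x, aK] = [γx, g_{[a]}K]`»); rank-generic form of ★ `exists_rational_rep`.
[cite: Milne2005ShimuraVarieties, Lemma 5.13 p. 57] -/
theorem exists_rational_inv_mul_rep_mem {n : ℕ} {J : Matrix (Fin n) (Fin n) L} {c : L ≃ₐ[↥(maximalRealSubfield L)] L}
    {K : Subgroup (finAdelic (↥(maximalRealSubfield L)) L c n J)}
    {gq : orbitRel.Quotient (rational (↥(maximalRealSubfield L)) L c n J)
        (CosetSpace (rationalToFinAdelic (↥(maximalRealSubfield L)) L c n J) K) →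
      finAdelic (↥(maximalRealSubfield L)) L c n J}
    (hgq : ∀ q, Quotient.mk'' (CosetSpace.pt (rationalToFinAdelic _ L _ n J) K (gq q)) = q)
    (a : finAdelic (↥(maximalRealSubfield L)) L c n J) :
    ∃ γ : rational (↥(maximalRealSubfield L)) L c n J,
      (rationalToFinAdelic _ L _ n J γ * a)⁻¹ *
          gq (Quotient.mk'' (CosetSpace.pt (rationalToFinAdelic _ L _ n J) K a)) ∈ K := by
  have h := hgq (Quotient.mk'' (CosetSpace.pt (rationalToFinAdelic _ L _ n J) K a))
  rw [Quotient.eq''] at h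
  obtain ⟨γ, hγ⟩ := MulAction.orbitRel_apply.mp h
  refine ⟨γ, ?_⟩
  change CosetSpace.pt (rationalToFinAdelic _ L _ n J) K (rationalToFinAdelic _ L _ n J γ * a) = _ at hγ
  exact (CosetSpace.pt_eq_pt_iff _ K _ _).mp hγ

omit [IsCMField L] in
/-- **Conjugating a natural level by a rational element**: if `g⁻¹ K g ≤ K'` and `(φ(γ) b g)⁻¹ b' ∈ K'`, then
`γ · Γ_J(bKb⁻¹) · γ⁻¹ ≤ Γ_J(b'K'b'⁻¹)` — the level condition under which `v ↦ γ v` descends to the quotients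
(`φ(γ) b K b⁻¹ φ(γ)⁻¹ = b' k'⁻¹ g⁻¹ K g k' b'⁻¹ ⊆ b' K' b'⁻¹`); rank-generic form of ★ `conj_arithmeticLevel_le`.
[cite: Milne2005ShimuraVarieties, §13 p. 118 L21–26] -/
theorem map_conj_arithmeticLevel_le {n : ℕ} {J : Matrix (Fin n) (Fin n) L} {c : L ≃ₐ[↥(maximalRealSubfield L)] L}
    {K K' : Subgroup (finAdelic (↥(maximalRealSubfield L)) L c n J)}
    {g b b' : finAdelic (↥(maximalRealSubfield L)) L c n J}
    (hK : ∀ k ∈ K, g⁻¹ * k * g ∈ K') {γ : rational (↥(maximalRealSubfield L)) L c n J}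
    (hγ : (rationalToFinAdelic _ L _ n J γ * b * g)⁻¹ * b' ∈ K') :
    (arithmeticLevel (↥(maximalRealSubfield L)) L c n J (K.map (MulAut.conj b).toMonoidHom)).map
        (MulAut.conj (γ : GL (Fin n) L)).toMonoidHom ≤
      arithmeticLevel (↥(maximalRealSubfield L)) L c n J (K'.map (MulAut.conj b').toMonoidHom) := by
  rintro _ ⟨δ, hδ, rfl⟩
  rw [SetLike.mem_coe, mem_arithmeticLevel_iff] at hδ
  rw [mem_arithmeticLevel_iff]
  obtain ⟨hδr, hδK⟩ := hδ
  obtain ⟨k, hk, hkδ⟩ := Subgroup.mem_map.mp hδK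
  have hγδ : (MulAut.conj (γ : GL (Fin n) L)).toMonoidHom δ ∈ rational (↥(maximalRealSubfield L)) L c n J := by
    change (γ : GL (Fin n) L) * δ * (γ : GL (Fin n) L)⁻¹ ∈ _
    exact Subgroup.mul_mem _ (Subgroup.mul_mem _ γ.2 hδr) (Subgroup.inv_mem _ γ.2)
  refine ⟨hγδ, ?_⟩
  set φ := rationalToFinAdelic (↥(maximalRealSubfield L)) L c n J with hφ
  set k' := (φ γ * b * g)⁻¹ * b' with hk'
  have hmapδ : φ ⟨(MulAut.conj (γ : GL (Fin n) L)).toMonoidHom δ, hγδ⟩ = φ γ * φ ⟨δ, hδr⟩ * (φ γ)⁻¹ := by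
    rw [← map_inv, ← map_mul, ← map_mul]
    rfl
  rw [hmapδ, ← hkδ]
  have hφγ : φ γ = b' * k'⁻¹ * g⁻¹ * b⁻¹ := by
    rw [hk']
    group
  refine Subgroup.mem_map.mpr ⟨k'⁻¹ * (g⁻¹ * k * g) * k', ?_, ?_⟩
  · exact K'.mul_mem (K'.mul_mem (K'.inv_mem hγ) (hK k hk)) hγ
  · change b' * (k'⁻¹ * (g⁻¹ * k * g) * k') * b'⁻¹ = φ γ * (b * k * b⁻¹) * (φ γ)⁻¹
    rw [hφγ]
    group

/-! ### §2. The rational action on the negative cone of `J⋆^τ` -/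

variable (L) (Jstar : Matrix (Fin 2) (Fin 2) L) (τ : L →+* ℂ)

/-- `U(J⋆)(L⁺)` preserves the negative cone of `J⋆^τ`: `γ^τ v` is negative when `v` is (★ `smul_ratToGLℂ_mulVec_mem_negCone`
at `c = 1`).  Private copy of the ★ decl of the same name in `UnitaryShimuraCurveEmbeddingInjective` (not imported here: that
module's cone is the embedding layer, foreign to the Hecke translates). [cite: BergeronMillsonMoeglin2016Balls, Part 2 §1.3] -/
private theorem ratToGLℂ_mulVec_mem_negCone_aux (γ : ↥(rational (↥(maximalRealSubfield L)) L (IsCMField.complexConj L) 2 Jstar))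
    {v : Fin 2 → ℂ} (hv : v ∈ negCone (Jstar.map τ)) :
    ((ratToGLℂ L Jstar τ γ : GL (Fin 2) ℂ) : Matrix (Fin 2) (Fin 2) ℂ) *ᵥ v ∈ negCone (Jstar.map τ) := by
  simpa only [one_smul] using smul_ratToGLℂ_mulVec_mem_negCone L Jstar τ γ one_ne_zero hv

/-- **`[γ^τ v, φ(γ) a K] = [v, aK]`** on `Sh_K(U(J⋆), 𝔻)(ℂ)` (★ `ShimuraSetGS.mk_smul_mulVec` at `c = 1`).
[cite: Milne2005ShimuraVarieties, §5 (5.1) p. 56 and Lemma 5.13 p. 57] -/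
theorem ShimuraSetGS.mk_ratToGLℂ_mulVec
    (K : Subgroup ↥(finAdelic (↥(maximalRealSubfield L)) L (IsCMField.complexConj L) 2 Jstar))
    (γ : ↥(rational (↥(maximalRealSubfield L)) L (IsCMField.complexConj L) 2 Jstar)) (v : Fin 2 → ℂ)
    (hv : v ∈ negCone (Jstar.map τ))
    (hγv : ((ratToGLℂ L Jstar τ γ : GL (Fin 2) ℂ) : Matrix (Fin 2) (Fin 2) ℂ) *ᵥ v ∈ negCone (Jstar.map τ))
    (a : ↥(finAdelic (↥(maximalRealSubfield L)) L (IsCMField.complexConj L) 2 Jstar)) :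
    ShimuraSetGS.mk L Jstar τ K (((ratToGLℂ L Jstar τ γ : GL (Fin 2) ℂ) : Matrix (Fin 2) (Fin 2) ℂ) *ᵥ v) hγv
        ((rationalToFinAdelic (↥(maximalRealSubfield L)) L (IsCMField.complexConj L) 2 Jstar γ :
          ↥(finAdelic (↥(maximalRealSubfield L)) L (IsCMField.complexConj L) 2 Jstar)) * a) =
      ShimuraSetGS.mk L Jstar τ K v hv a := by
  rw [ShimuraSetGS.mk_eq_mk_iff]
  exact ⟨γ, 1, one_ne_zero, one_smul _ _, rfl⟩

/-- **`[v, aK] = [δ^τ v, bK]` whenever `(φ(δ) a)⁻¹ b ∈ K`** — the class of a point read on the representative `b` of its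
double coset (`mk_ratToGLℂ_mulVec` + ★ `ShimuraSetGS.mk_mul_of_mem`; the negativity witness of `δ^τ v` is an argument, any proof
serves). [cite: Milne2005ShimuraVarieties, Lemma 5.13 p. 57] -/
theorem ShimuraSetGS.mk_eq_mk_ratToGLℂ_mulVec_of_mem
    (K : Subgroup ↥(finAdelic (↥(maximalRealSubfield L)) L (IsCMField.complexConj L) 2 Jstar))
    (δ : ↥(rational (↥(maximalRealSubfield L)) L (IsCMField.complexConj L) 2 Jstar)) (v : Fin 2 → ℂ)
    (hv : v ∈ negCone (Jstar.map τ))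
    (hδv : ((ratToGLℂ L Jstar τ δ : GL (Fin 2) ℂ) : Matrix (Fin 2) (Fin 2) ℂ) *ᵥ v ∈ negCone (Jstar.map τ))
    {a b : ↥(finAdelic (↥(maximalRealSubfield L)) L (IsCMField.complexConj L) 2 Jstar)}
    (h : ((rationalToFinAdelic (↥(maximalRealSubfield L)) L (IsCMField.complexConj L) 2 Jstar δ :
        ↥(finAdelic (↥(maximalRealSubfield L)) L (IsCMField.complexConj L) 2 Jstar)) * a)⁻¹ * b ∈ K) :
    ShimuraSetGS.mk L Jstar τ K v hv a =
      ShimuraSetGS.mk L Jstar τ K (((ratToGLℂ L Jstar τ δ : GL (Fin 2) ℂ) : Matrix (Fin 2) (Fin 2) ℂ) *ᵥ v) hδv b := by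
  rw [← ShimuraSetGS.mk_ratToGLℂ_mulVec L Jstar τ K δ v hv hδv a, ← ShimuraSetGS.mk_mul_of_mem L Jstar τ K _ hδv _ h,
    mul_inv_cancel_left]

variable {L Jstar τ}

/-! ### §3. The Hecke translate of the complex fibre of the curve is a morphism -/

variable {K₀ : C5.OpenCompactSubgroup ↥(finAdelic (↥(maximalRealSubfield L)) L (IsCMField.complexConj L) 2 Jstar)}

/-- **The piece morphism**: for disc-quotient pieces `X`, `X'` of the record with complex form `J⋆^τ` and groups
`τ(Γ_{J⋆}(bKb⁻¹))`, `τ(Γ_{J⋆}(b'K'b'⁻¹))`, a rational `γ` with `(φ(γ) b g)⁻¹ b' ∈ K'` (and `g⁻¹Kg ≤ K'`) translates `X → X'`,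
`[v] ↦ [γ^τ v]`, by a `ℂ`-MORPHISM (★ `UnitaryConeHeckeTranslation.exists_hom_map_unif_mulVec_eq_of_nonempty`; isometry
`conjTranspose_ratToGLℂ_mul`, levels `map_conj_arithmeticLevel_le`, Hodge models ★ `exists_isReal_hodgeModel_holds 1`, GAGA ★
`arapura2012_cor_15_4_6_holds`). [cite: Milne2005ShimuraVarieties, §13 p. 118 L21–26] [cite: Arapura2012, §15.4 Cor. 15.4.6] -/
theorem exists_hom_piece_ratToGLℂ {X X' : SchemeOver ℂ} (B : UnitaryBallUniformisationDatum 1 X)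
    (B' : UnitaryBallUniformisationDatum 1 X')
    {K K' : Subgroup ↥(finAdelic (↥(maximalRealSubfield L)) L (IsCMField.complexConj L) 2 Jstar)}
    {g b b' : ↥(finAdelic (↥(maximalRealSubfield L)) L (IsCMField.complexConj L) 2 Jstar)}
    (hH : B.Hℂ = Jstar.map τ) (hH' : B'.Hℂ = Jstar.map τ)
    (hΓ : B.Γ.map (Matrix.GeneralLinearGroup.map B.τ₁) =
      (arithmeticLevel (↥(maximalRealSubfield L)) L (IsCMField.complexConj L) 2 Jstar
        (K.map (MulAut.conj b).toMonoidHom)).map (Matrix.GeneralLinearGroup.map τ))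
    (hΓ' : B'.Γ.map (Matrix.GeneralLinearGroup.map B'.τ₁) =
      (arithmeticLevel (↥(maximalRealSubfield L)) L (IsCMField.complexConj L) 2 Jstar
        (K'.map (MulAut.conj b').toMonoidHom)).map (Matrix.GeneralLinearGroup.map τ))
    (hK : ∀ k ∈ K, g⁻¹ * k * g ∈ K') (γ : ↥(rational (↥(maximalRealSubfield L)) L (IsCMField.complexConj L) 2 Jstar))
    (hγ : ((rationalToFinAdelic (↥(maximalRealSubfield L)) L (IsCMField.complexConj L) 2 Jstar γ :
        ↥(finAdelic (↥(maximalRealSubfield L)) L (IsCMField.complexConj L) 2 Jstar)) * b * g)⁻¹ * b' ∈ K') :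
    ∃ f : X ⟶ X', ∀ v ∈ B.cone, AlgPoints.map f (B.unif v) =
      B'.unif (((ratToGLℂ L Jstar τ γ : GL (Fin 2) ℂ) : Matrix (Fin 2) (Fin 2) ℂ) *ᵥ v) := by
  have hHM : Nonempty (HodgeModel 1 X) :=
    let ⟨A, _⟩ := HodgeTheory.exists_isReal_hodgeModel_holds 1 X B.isSmoothProjective; ⟨A⟩
  have hHM' : Nonempty (HodgeModel 1 X') :=
    let ⟨A, _⟩ := HodgeTheory.exists_isReal_hodgeModel_holds 1 X' B'.isSmoothProjective; ⟨A⟩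
  refine UnitaryConeHeckeTranslation.exists_hom_map_unif_mulVec_eq_of_nonempty arapura2012_cor_15_4_6_holds hHM hHM' ?_ ?_
  · rw [hH, hH']
    exact conjTranspose_ratToGLℂ_mul L Jstar τ γ
  · rw [hΓ, hΓ', Subgroup.map_map]
    have hcomm : ((MulAut.conj (ratToGLℂ L Jstar τ γ)).toMonoidHom).comp (Matrix.GeneralLinearGroup.map (n := Fin 2) τ) =
        (Matrix.GeneralLinearGroup.map (n := Fin 2) τ).comp
          (MulAut.conj ((γ : ↥(rational (↥(maximalRealSubfield L)) L (IsCMField.complexConj L) 2 Jstar)) :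
            GL (Fin 2) L)).toMonoidHom := by
      ext δ i j
      simp [MulAut.conj_apply, map_mul, map_inv, ratToGLℂ]
    rw [hcomm, ← Subgroup.map_map]
    exact Subgroup.map_mono (map_conj_arithmeticLevel_le (K := K) (K' := K') hK hγ)

set_option maxHeartbeats 400000 in
/-- **[Milne2005ShimuraVarieties] §13 p. 118 L25–26 for the curve record** («The map `T(g)` is a morphism of algebraic
varieties over `ℂ`»): for `g⁻¹Kg ≤ K'` there is a morphism `T_ℂ : (M_K)_τ → (M_{K'})_τ` over `ℂ` of the complex fibres
of Deligne's canonical model of the unitary Shimura CURVE acting on complex points as `[v, aK] ↦ [v, agK']` (points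
read through the record's `pts` and `AlgPoints.baseChangeEquiv τ`).  Built piece by piece on the record's `pieces`
cofan from the Hecke translations of compact disc quotients (★ `UnitaryConeHeckeTranslation.exists_hom_map_unif_mulVec_eq_of_nonempty`:
holomorphy by descent along the open uniformisation of the ONE-dimensional pieces, algebraicity by Arapura
Cor. 15.4.6 = ★ `arapura2012_cor_15_4_6_holds`, Hodge models by ★ `exists_isReal_hodgeModel_holds 1`) and glued by
`Cofan.IsColimit.desc`.  This is exactly the hypothesis `hC` of the descent half `RecordSystemGS.heckeTranslateDefinedOver_of_complex`
([Milne2005ShimuraVarieties] Thm. 13.6). [cite: Milne2005ShimuraVarieties, §13 p. 118 L21–26; Lemma 5.13 p. 57]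
[cite: Deligne1979ShimuraVarieties, 2.1.2–2.1.4] [cite: Arapura2012, §15.4 Cor. 15.4.6] -/
theorem RecordSystemGS.exists_heckeComplex (S : RecordSystemGS L Jstar τ K₀) (K K' : C5.SmallLevel K₀)
    (g : ↥(finAdelic (↥(maximalRealSubfield L)) L (IsCMField.complexConj L) 2 Jstar))
    (hK : ∀ k ∈ K.1.1, g⁻¹ * k * g ∈ K'.1.1) :
    letI : Algebra L ℂ := τ.toAlgebra
    ∃ Tc : (Motives.baseChangeHom τ).obj (S.M.obj K) ⟶ (Motives.baseChangeHom τ).obj (S.M.obj K'),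
      ∀ (v : Fin 2 → ℂ) (hv : v ∈ negCone (Jstar.map τ))
        (a : ↥(finAdelic (↥(maximalRealSubfield L)) L (IsCMField.complexConj L) 2 Jstar)),
        AlgPoints.map Tc (AlgPoints.baseChangeEquiv τ (S.M.obj K)
          ((S.pts K).symm (ShimuraSetGS.mk L Jstar τ K.1.1 v hv a))) =
        AlgPoints.baseChangeEquiv τ (S.M.obj K')
          ((S.pts K').symm (ShimuraSetGS.mk L Jstar τ K'.1.1 v hv (a * g))) := by
  letI : Algebra L ℂ := τ.toAlgebra
  classical
  obtain ⟨gq, hgq, X, ι, hcol, B, hB⟩ := S.pieces K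
  obtain ⟨gq', hgq', X', ι', hcol', B', hB'⟩ := S.pieces K'
  -- for each piece `q`: the target class `q'` and a rational `γ_q` with `(φ(γ_q) g_q g)⁻¹ g'_{q'} ∈ K'`
  let q' : orbitRel.Quotient ↥(rational (↥(maximalRealSubfield L)) L (IsCMField.complexConj L) 2 Jstar)
      (CosetSpace (rationalToFinAdelic (↥(maximalRealSubfield L)) L (IsCMField.complexConj L) 2 Jstar) K.1.1) →
      orbitRel.Quotient ↥(rational (↥(maximalRealSubfield L)) L (IsCMField.complexConj L) 2 Jstar)
      (CosetSpace (rationalToFinAdelic (↥(maximalRealSubfield L)) L (IsCMField.complexConj L) 2 Jstar) K'.1.1) :=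
    fun q => Quotient.mk'' (CosetSpace.pt (rationalToFinAdelic (↥(maximalRealSubfield L)) L (IsCMField.complexConj L) 2 Jstar)
      K'.1.1 (gq q * g))
  have hrep : ∀ q, ∃ γ : ↥(rational (↥(maximalRealSubfield L)) L (IsCMField.complexConj L) 2 Jstar),
      ((rationalToFinAdelic (↥(maximalRealSubfield L)) L (IsCMField.complexConj L) 2 Jstar γ :
          ↥(finAdelic (↥(maximalRealSubfield L)) L (IsCMField.complexConj L) 2 Jstar)) * (gq q * g))⁻¹ *
        gq' (q' q) ∈ K'.1.1 :=
    fun q => exists_rational_inv_mul_rep_mem hgq' (gq q * g)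
  choose γ hγ using hrep
  -- the piece morphisms `X_q ⟶ X'_{q'}`, `[v] ↦ [γ_q^τ v]` (one-dimensional pieces: `exists_hom_piece_ratToGLℂ`)
  have hpiece : ∀ q, ∃ f : X q ⟶ X' (q' q), ∀ v ∈ (B q).cone, AlgPoints.map f ((B q).unif v) =
      (B' (q' q)).unif (((ratToGLℂ L Jstar τ (γ q) : GL (Fin 2) ℂ) : Matrix (Fin 2) (Fin 2) ℂ) *ᵥ v) := fun q => by
    have hγq := hγ q
    rw [← mul_assoc] at hγq
    exact exists_hom_piece_ratToGLℂ (B q) (B' (q' q)) (hB q).1 (hB' (q' q)).1 (hB q).2.1 (hB' (q' q)).2.1 hK (γ q) hγq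
  choose f hf using hpiece
  -- glue along the coproduct
  refine ⟨Cofan.IsColimit.desc hcol fun q => f q ≫ ι' (q' q), fun v hv a => ?_⟩
  -- the point `[v, aK]` lies on the piece of `q = [a]` (`q` made opaque by `generalize`; no `set`, which is what costs
  -- the rank-3 twin its 1.6 M heartbeats)
  obtain ⟨δ, hδ⟩ := exists_rational_inv_mul_rep_mem hgq a
  generalize Quotient.mk'' (CosetSpace.pt (rationalToFinAdelic (↥(maximalRealSubfield L)) L (IsCMField.complexConj L) 2 Jstar)
    K.1.1 a) = q at hδ
  -- the `g`-conjugate `(φ(δ) a g)⁻¹ (g_q g) ∈ K'`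
  have hk' : ((rationalToFinAdelic (↥(maximalRealSubfield L)) L (IsCMField.complexConj L) 2 Jstar δ :
        ↥(finAdelic (↥(maximalRealSubfield L)) L (IsCMField.complexConj L) 2 Jstar)) * (a * g))⁻¹ * (gq q * g) ∈ K'.1.1 := by
    have h := hK _ hδ
    have heq : ((rationalToFinAdelic (↥(maximalRealSubfield L)) L (IsCMField.complexConj L) 2 Jstar δ :
          ↥(finAdelic (↥(maximalRealSubfield L)) L (IsCMField.complexConj L) 2 Jstar)) * (a * g))⁻¹ * (gq q * g) =
        g⁻¹ * (((rationalToFinAdelic (↥(maximalRealSubfield L)) L (IsCMField.complexConj L) 2 Jstar δ :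
          ↥(finAdelic (↥(maximalRealSubfield L)) L (IsCMField.complexConj L) 2 Jstar)) * a)⁻¹ * gq q) * g := by
      group
    rw [heq]
    exact h
  -- `[v, aK] = [x, g_q K]`, `[v, agK'] = [x, g_q g K']`, `[x, g_q g K'] = [γ_q^τ x, g'_{q'} K']` with `x := δ^τ v`
  have hxneg : (((ratToGLℂ L Jstar τ δ : GL (Fin 2) ℂ) : Matrix (Fin 2) (Fin 2) ℂ) *ᵥ v) ∈ negCone (Jstar.map τ) :=
    ratToGLℂ_mulVec_mem_negCone_aux L Jstar τ δ hv
  have hza : ShimuraSetGS.mk L Jstar τ K.1.1 v hv a = ShimuraSetGS.mk L Jstar τ K.1.1 _ hxneg (gq q) :=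
    ShimuraSetGS.mk_eq_mk_ratToGLℂ_mulVec_of_mem L Jstar τ K.1.1 δ v hv hxneg hδ
  have hza' : ShimuraSetGS.mk L Jstar τ K'.1.1 v hv (a * g) = ShimuraSetGS.mk L Jstar τ K'.1.1 _ hxneg (gq q * g) :=
    ShimuraSetGS.mk_eq_mk_ratToGLℂ_mulVec_of_mem L Jstar τ K'.1.1 δ v hv hxneg hk'
  have hγx : ((ratToGLℂ L Jstar τ (γ q) : GL (Fin 2) ℂ) : Matrix (Fin 2) (Fin 2) ℂ) *ᵥ (((ratToGLℂ L Jstar τ δ : GL (Fin 2) ℂ) : Matrix (Fin 2) (Fin 2) ℂ) *ᵥ v) ∈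
      negCone (Jstar.map τ) :=
    ratToGLℂ_mulVec_mem_negCone_aux L Jstar τ (γ q) hxneg
  have hxq : ShimuraSetGS.mk L Jstar τ K'.1.1 _ hxneg (gq q * g) = ShimuraSetGS.mk L Jstar τ K'.1.1 _ hγx (gq' (q' q)) :=
    ShimuraSetGS.mk_eq_mk_ratToGLℂ_mulVec_of_mem L Jstar τ K'.1.1 (γ q) _ hxneg hγx (hγ q)
  -- read both sides through the pieces: a `calc` by `congrArg` only (NO `rw`/`simp` on the glued goal: abstracting
  -- `[v, aK]` there makes the unifier compare `a` with `a * g` by unfolding adèlic matrix products — the rank-3 twin's 1.6 M heartbeats)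
  have hcone : (((ratToGLℂ L Jstar τ δ : GL (Fin 2) ℂ) : Matrix (Fin 2) (Fin 2) ℂ) *ᵥ v) ∈ (B q).cone := by
    change _ ∈ negCone (B q).Hℂ
    rw [(hB q).1]
    exact hxneg
  calc AlgPoints.map (Cofan.IsColimit.desc hcol fun q => f q ≫ ι' (q' q))
        (AlgPoints.baseChangeEquiv τ (S.M.obj K) ((S.pts K).symm (ShimuraSetGS.mk L Jstar τ K.1.1 v hv a)))
      = AlgPoints.map (Cofan.IsColimit.desc hcol fun q => f q ≫ ι' (q' q))
          (AlgPoints.baseChangeEquiv τ (S.M.obj K) ((S.pts K).symm (ShimuraSetGS.mk L Jstar τ K.1.1 _ hxneg (gq q)))) :=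
        congrArg (fun P => AlgPoints.map (Cofan.IsColimit.desc hcol fun q => f q ≫ ι' (q' q)) (AlgPoints.baseChangeEquiv τ (S.M.obj K) ((S.pts K).symm P))) hza
    _ = AlgPoints.map (Cofan.IsColimit.desc hcol fun q => f q ≫ ι' (q' q)) (AlgPoints.map (ι q) ((B q).unif (((ratToGLℂ L Jstar τ δ : GL (Fin 2) ℂ) : Matrix (Fin 2) (Fin 2) ℂ) *ᵥ v))) :=
        congrArg (AlgPoints.map (Cofan.IsColimit.desc hcol fun q => f q ≫ ι' (q' q))) ((hB q).2.2 _ hxneg).symm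
    _ = AlgPoints.map (ι q ≫ (Cofan.IsColimit.desc hcol fun q => f q ≫ ι' (q' q))) ((B q).unif (((ratToGLℂ L Jstar τ δ : GL (Fin 2) ℂ) : Matrix (Fin 2) (Fin 2) ℂ) *ᵥ v)) := (AlgPoints.map_comp_apply _ _ _).symm
    _ = AlgPoints.map (f q ≫ ι' (q' q)) ((B q).unif (((ratToGLℂ L Jstar τ δ : GL (Fin 2) ℂ) : Matrix (Fin 2) (Fin 2) ℂ) *ᵥ v)) :=
        congrArg (fun φ => AlgPoints.map φ ((B q).unif (((ratToGLℂ L Jstar τ δ : GL (Fin 2) ℂ) : Matrix (Fin 2) (Fin 2) ℂ) *ᵥ v))) (Cofan.IsColimit.fac hcol _ q)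
    _ = AlgPoints.map (ι' (q' q)) (AlgPoints.map (f q) ((B q).unif (((ratToGLℂ L Jstar τ δ : GL (Fin 2) ℂ) : Matrix (Fin 2) (Fin 2) ℂ) *ᵥ v))) := AlgPoints.map_comp_apply _ _ _
    _ = AlgPoints.map (ι' (q' q)) ((B' (q' q)).unif (((ratToGLℂ L Jstar τ (γ q) : GL (Fin 2) ℂ) : Matrix (Fin 2) (Fin 2) ℂ) *ᵥ (((ratToGLℂ L Jstar τ δ : GL (Fin 2) ℂ) : Matrix (Fin 2) (Fin 2) ℂ) *ᵥ v))) := congrArg _ (hf q _ hcone)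
    _ = AlgPoints.baseChangeEquiv τ (S.M.obj K')
          ((S.pts K').symm (ShimuraSetGS.mk L Jstar τ K'.1.1 _ hγx (gq' (q' q)))) := (hB' (q' q)).2.2 _ hγx
    _ = AlgPoints.baseChangeEquiv τ (S.M.obj K') ((S.pts K').symm (ShimuraSetGS.mk L Jstar τ K'.1.1 v hv (a * g))) :=
        congrArg (fun P => AlgPoints.baseChangeEquiv τ (S.M.obj K') ((S.pts K').symm P)) (hza'.trans hxq).symm

end Literature.AlgebraicGeometry.ShimuraVarieties.UnitaryCanonicalModel

end
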